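import Summits.AtomisticToContinuum.HydrodynamicLimit.Theorems.AntiMazurCoboundariesKineticFluxLdDecayHTheoremReduction
import Summits.AtomisticToContinuum.HydrodynamicLimit.Theorems.AntiMazurCoboundariesKineticFluxLdDecayHTheoremObjectsE
import HarnessLib

/-!
# The H-theorem reduction of the crux `KineticFluxLdDecay` (stmt-AtomisticToContinuum-10967), vanishing form:
# `VanishingWindowDissipationTilt → KineticFluxLdDecay` (both route copies), sorry-free

Line `h-theorem-dissipation-budget` (lead c5, reshape 4), registered stub `stub_vanishingReduction` of the skeleton
`Cruxes/KineticFluxLdDecay/Lines/h_theorem_dissipation_budget.lean`. The landed reduction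
`Reduction.lintegral_exp_windowAvg_le` (`Theorems/…HTheoremReduction.lean`, p140516) consumes the rate-bearing bet
`NoPerpetualDissipationTilt` (`∫₀ʰ 𝒟 ≤ (h/τ)(A s + B)` for ALL windows `τ`) but never uses the rate: after AM–GM
`√d ≤ d/(2r) + r/2` the cut production enters the gain bound linearly, so only SMALLNESS of the window-averaged cut
production of the optimal enemy `G_N^X` at SOME window is needed. This file re-runs the landed composition against that
weaker core `VanishingWindowDissipationTilt` (objects part E, `Theorems/…HTheoremObjectsE.lean`): same constants
`L = 8κ₁ + 16κ₁/δ + 2`, `K = e^L`, `C₁ = C + 1`, `r = δ/(4C₁)`, with the tolerance `η = rδ/(4C₁)` (so that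
`C₁η/(2r) = δ/8`) in place of `(A s + B)/τ`, and the window `τ(η)` and threshold `N₀(η)` SUPPLIED by the core instead
of chosen by a formula. The per-time kinetic bound is verbatim the landed one (`Reduction.perTime_arith`,
`Reduction.sqrt_le_amgm`); only the closing budget arithmetic changes (`VanishingReduction.budget_arith_vanishing`).
-/

noncomputable section

open MeasureTheory ProbabilityTheory Set Filter InformationTheory
open scoped ENNReal

namespace Summit.AtomisticToContinuum.HydrodynamicLimit.Theorems.HTheorem

open Literature.MathematicalPhysics.KineticTheory (T3 V3 hsDiameter localGibbsLaw)
open Literature.Analysis.FluidPDE (HardSphereFlow Config)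

namespace VanishingReduction

open Reduction

/-- The budget arithmetic of the vanishing form: with `K, r, η` chosen so that `2κ₁/log K ≤ ¼`, `4κ₁/log K ≤ δ/4`,
`C₁η/(2r) ≤ δ/8`, `C₁r/2 ≤ δ/8`, a gain bound `X ≤ n(C₁r/2 + 4κ₁/log K) + S(½ + 2κ₁/log K) + (nC₁/(2r))·η` gives
`X − S ≤ δ n` (indeed `X − S ≤ δn/2 − S/4`). -/
theorem budget_arith_vanishing {n C₁ r S δ X q η : ℝ} (hn : 0 < n) (hS : 0 ≤ S) (hδ : 0 < δ)
    (hq1 : 2 * q ≤ 1 / 4) (hq2 : 4 * q ≤ δ / 4)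
    (h2 : C₁ * η / (2 * r) ≤ δ / 8) (h3 : C₁ * r / 2 ≤ δ / 8)
    (hX : X ≤ n * (C₁ * r / 2 + 4 * q) + S * (1 / 2 + 2 * q) + n * C₁ / (2 * r) * η) :
    X - S ≤ δ * n := by
  have e1 : n * C₁ / (2 * r) * η = n * (C₁ * η / (2 * r)) := by ring
  rw [e1] at hX
  have i2 : n * (C₁ * η / (2 * r)) ≤ n * (δ / 8) := mul_le_mul_of_nonneg_left h2 hn.le
  have i3 : n * (C₁ * r / 2 + 4 * q) ≤ n * (δ / 8 + δ / 4) := mul_le_mul_of_nonneg_left (by linarith) hn.le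
  have i4 : S * (1 / 2 + 2 * q) ≤ S * (1 / 2 + 1 / 4) := mul_le_mul_of_nonneg_left (by linarith) hS
  nlinarith [mul_pos hδ hn]

/-- **The LD bound of the line from the core, in the frame's vocabulary.** Under the landed stubs and the core
`VanishingWindowDissipationTilt`: for constant profiles `a, θ > 0`, `u₀`, there is `σ₀ > 0` such that for
`0 < σ < σ₀` the global Gibbs laws are probability laws and, with the amplitude `min κ₁ κ_b` (`κ₁` of
`GainDominationLocal`, `κ_b` of the core), every admissible `φ, g` and `δ > 0` admit a window `τ` and `N₀` with
`E_{G_N} exp(X) ≤ e^{δ(N+1)}` for all `N ≥ N₀` and every flow. Re-run of `Reduction.lintegral_exp_windowAvg_le` with the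
tolerance `η = rδ/(4C₁)` handed to the core at the cut `K = exp(8κ₁ + 16κ₁/δ + 2)`. -/
theorem lintegral_exp_windowAvg_le_of_vanishing (hA : WindowDuality) (hB : OneBodyMarginal)
    (hC : VelocityEntropyBudget) (hD : GainDominationLocal) (hP : PositionTailBudget)
    (hE : VanishingWindowDissipationTilt)
    (a θ : ℝ) (u₀ : V3) (ha : 0 < a) (hθ : 0 < θ) :
    ∃ σ₀ : ℝ, 0 < σ₀ ∧ ∀ σ : ℝ, 0 < σ → σ < σ₀ →
      (∀ (N : ℕ) (Φ : Flow σ N), IsProbabilityMeasure (gibbs σ a θ u₀ N Φ)) ∧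
      ∃ κ : ℝ, 0 < κ ∧ ∀ (φ : T3 → ℝ) (g : V3 → ℝ), Continuous φ → Continuous g →
        (∀ x, |φ x| ≤ 1) → (∀ v, |g v| ≤ κ) → Orthogonal g →
        ∀ δ : ℝ, 0 < δ → ∃ τ : ℝ, 0 < τ ∧ ∃ N₀ : ℕ, ∀ N : ℕ, N₀ ≤ N → ∀ Φ : Flow σ N,
          ∫⁻ z, ENNReal.ofReal (Real.exp (windowAvg Φ (fluxObs θ u₀ φ g N) (window τ N) z))
              ∂(gibbs σ a θ u₀ N Φ) ≤ ENNReal.ofReal (Real.exp (δ * (N + 1))) := by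
  obtain ⟨σ₁, hσ₁, hE1⟩ := hE a θ u₀ ha hθ
  obtain ⟨κ₁, hκ₁, hD1⟩ := hD
  refine ⟨min σ₁ (1 / 4), lt_min hσ₁ (by norm_num), fun σ hσ hσlt => ?_⟩
  have hσ1 : σ < σ₁ := hσlt.trans_le (min_le_left _ _)
  have hσ4 : σ ≤ 1 / 4 := (hσlt.trans_le (min_le_right _ _)).le
  have hσ2 : σ ≤ 1 / 2 := hσ4.trans (by norm_num)
  obtain ⟨κb, hκb, hEb⟩ := hE1 σ hσ hσ1
  refine ⟨fun N Φ => isProbabilityMeasure_gibbs ha hθ hσ2 u₀ N Φ, min κ₁ κb, lt_min hκ₁ hκb, ?_⟩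
  intro φ g hφ hg hφ1 hgκ' horth δ hδ
  have hgκ : ∀ v, |g v| ≤ κ₁ := fun v => (hgκ' v).trans (min_le_left _ _)
  have hgκb : ∀ v, |g v| ≤ κb := fun v => (hgκ' v).trans (min_le_right _ _)
  obtain ⟨C, hC0, hD2⟩ := hD1 g hg hgκ horth
  -- constants: cut level `K = e^L`, `C₁`, `r`, the tolerance `η`; then `τ, N₀` from the core
  set L : ℝ := 8 * κ₁ + 16 * κ₁ / δ + 2 with hLdef
  have hL0 : 0 < L := by positivity
  have hL2 : 2 ≤ L := by
    have : 0 ≤ 8 * κ₁ + 16 * κ₁ / δ := by positivity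
    linarith
  have hq1 : 2 * (κ₁ / L) ≤ 1 / 4 := by
    rw [mul_div_assoc', div_le_iff₀ hL0]
    have : 0 ≤ 16 * κ₁ / δ := by positivity
    nlinarith
  have hq2 : 4 * (κ₁ / L) ≤ δ / 4 := by
    rw [mul_div_assoc', div_le_iff₀ hL0]
    have h16 : 16 * κ₁ / δ * δ = 16 * κ₁ := by field_simp
    nlinarith [mul_le_mul_of_nonneg_right hL2 hδ.le]
  set K : ℝ := Real.exp L with hKdef
  have hK1 : 1 ≤ K := Real.one_le_exp hL0.le
  have hKe : Real.exp 2 ≤ K := Real.exp_le_exp.2 hL2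
  have hlogK : Real.log K = L := Real.log_exp L
  set C₁ : ℝ := C + 1 with hC₁
  have hC₁0 : 0 < C₁ := by positivity
  set r : ℝ := δ / (4 * C₁) with hr
  have hr0 : 0 < r := by positivity
  set η : ℝ := r * δ / (4 * C₁) with hηdef
  have hη0 : 0 < η := by positivity
  have h2 : C₁ * η / (2 * r) ≤ δ / 8 := by
    have e : C₁ * η / (2 * r) = δ / 8 := by
      rw [hηdef]
      field_simp
      ring
    exact e.le
  have h3 : C₁ * r / 2 ≤ δ / 8 := by
    rw [hr]
    field_simp
    nlinarith
  obtain ⟨τ, hτ, N₀, hE3⟩ := hEb φ g hφ hg hφ1 hgκb horth K hK1 η hη0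
  refine ⟨τ, hτ, N₀, fun N hN Φ => ?_⟩
  -- frame at fixed `N`, `Φ` (verbatim the landed reduction)
  haveI hGP : IsProbabilityMeasure (gibbs σ a θ u₀ N Φ) := isProbabilityMeasure_gibbs ha hθ hσ2 u₀ N Φ
  have hgood : gibbs σ a θ u₀ N Φ Φ.goodᶜ = 0 :=
    gibbs_absolutelyContinuous σ a θ u₀ N Φ Φ.measure_compl_good
  have hFm : Measurable (fluxObs θ u₀ φ g N) := measurable_fluxObs θ u₀ hφ.measurable hg.measurable N
  have hFb : ∀ z, |fluxObs θ u₀ φ g N z| ≤ ((N + 1 : ℕ) : ℝ) * κ₁ := abs_fluxObs_le θ u₀ hφ1 hgκ N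
  have hh : 0 < window τ N := mul_pos hτ (Real.rpow_pos_of_pos (by positivity) _)
  -- the core at this `N`, `Φ` (the tilted law is the composition's `ν` by `rfl`, `stub_hTheoremObjectsC`)
  have hE4 : ∫⁻ t in Set.Ioo 0 (window τ N),
      production (cutDensity K θ u₀ Φ ((gibbs σ a θ u₀ N Φ).tilted
        (windowAvg Φ (fluxObs θ u₀ φ g N) (window τ N))) t) ≤ ENNReal.ofReal (η * window τ N) :=
    hE3 N hN Φ
  obtain ⟨hνP, hνac, hνkl, hlhs, hii, hfub⟩ :=
    hA _ _ Φ (gibbs σ a θ u₀ N Φ) hGP hgood (fluxObs θ u₀ φ g N) hFm ⟨_, hFb⟩ (window τ N) hh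
  -- abbreviations
  set G : Measure (Phase N) := gibbs σ a θ u₀ N Φ with hGdef
  set F : Phase N → ℝ := fluxObs θ u₀ φ g N with hFdef
  set h : ℝ := window τ N with hhdef
  set ν : Measure (Phase N) := G.tilted (windowAvg Φ F h) with hνdef
  haveI : IsProbabilityMeasure ν := hνP
  rw [hlhs]
  refine ENNReal.ofReal_le_ofReal (Real.exp_le_exp.2 ?_)
  set S : ℝ := (klDiv ν G).toReal with hSdef
  have hS0 : 0 ≤ S := ENNReal.toReal_nonneg
  have hn : (0 : ℝ) < ((N + 1 : ℕ) : ℝ) := by positivity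
  -- the per-time gain bound, in `∫⁻` currency (verbatim the landed reduction)
  set k : ℝ := ((N + 1 : ℕ) : ℝ) * (C₁ * r / 2 + 4 * (κ₁ / L)) + S * (1 / 2 + 2 * (κ₁ / L)) with hkdef
  set c : ℝ := ((N + 1 : ℕ) : ℝ) * C₁ / (2 * r) with hcdef
  have hc0 : 0 < c := by positivity
  have key : ∀ t : ℝ, ENNReal.ofReal ((∫ z, F (Φ.flow t z) ∂ν) - k) ≤
      ENNReal.ofReal c * production (cutDensity K θ u₀ Φ ν t) := by
    intro t
    obtain ⟨hfP, hfac, hid⟩ := hB σ a θ u₀ N Φ ν hνP hθ hνac t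
    obtain ⟨hvk, hvel⟩ := hC σ a θ u₀ N Φ ν hνP ha hθ hσ2 hνac hνkl t
    have htail := hP σ a θ u₀ N Φ ν hνP ha hθ hσ hσ2 hνac hνkl t K hKe
    rw [hlogK] at htail
    rw [hid φ g hφ.measurable hg.measurable ⟨1, hφ1⟩ ⟨κ₁, hgκ⟩]
    -- split the gain at the cut `E = {n_t ≤ K}`
    set f : Measure (T3 × V3) := oneBodyLaw θ u₀ Φ ν t with hfdef
    haveI : IsProbabilityMeasure f := hfP
    set E : Set T3 := {x | posDensity θ u₀ Φ ν t x ≤ K} with hEdef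
    have hEm : MeasurableSet E := measurableSet_posDensity_le θ u₀ Φ ν t K
    have hsplit : ∫ y, φ y.1 * g y.2 ∂f =
        (∫ y, Set.indicator E φ y.1 * g y.2 ∂f) + ∫ y, Set.indicator Eᶜ φ y.1 * g y.2 ∂f := by
      have hind : ∀ x, Set.indicator E φ x + Set.indicator Eᶜ φ x = φ x := fun x => by
        by_cases hx : x ∈ E
        · rw [Set.indicator_of_mem hx, Set.indicator_of_notMem (fun h : x ∈ Eᶜ => h hx), add_zero]
        · rw [Set.indicator_of_notMem hx, Set.indicator_of_mem (Set.mem_compl hx), zero_add]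
      rw [← integral_add]
      · refine integral_congr_ae (ae_of_all _ fun y => ?_)
        show φ y.1 * g y.2 = Set.indicator E φ y.1 * g y.2 + Set.indicator Eᶜ φ y.1 * g y.2
        rw [← add_mul, hind]
      · exact integrable_of_abs_le_mul hEm hφ.measurable hg.measurable hφ1 hgκ
      · exact integrable_of_abs_le_mul hEm.compl hφ.measurable hg.measurable hφ1 hgκ
    have hhigh : ∫ y, Set.indicator Eᶜ φ y.1 * g y.2 ∂f ≤ κ₁ * (f.fst Eᶜ).toReal :=
      integral_indicator_compl_mul_le hφ1 hgκ hEm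
    have hEc : f.fst Eᶜ = f.fst {x | K < posDensity θ u₀ Φ ν t x} := by
      congr 1
      ext x
      simp [hEdef]
    rw [hEc] at hhigh
    by_cases htop : production (cutDensity K θ u₀ Φ ν t) = ⊤
    · rw [htop, ENNReal.mul_top (by simpa using hc0)]
      exact le_top
    · obtain ⟨d, hd0, hdeq⟩ : ∃ d : ℝ, 0 ≤ d ∧ production (cutDensity K θ u₀ Φ ν t) = ENNReal.ofReal d :=
        ⟨_, ENNReal.toReal_nonneg, (ENNReal.ofReal_toReal htop).symm⟩
      have hdle : production (Set.indicator (E ×ˢ Set.univ) (fun y => (f.rnDeriv refMeasure y).toReal)) ≤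
          ENNReal.ofReal d := hdeq.le
      have hgain := hD2 φ hφ.measurable hφ1 E hEm f hfP hfac hvk d hd0 hdle
      have hmain := perTime_arith (C := C) (C₁ := C₁) hn (by linarith only [hC₁]) hC₁0.le hr0 hκ₁.le hL0
        (Real.sqrt_nonneg d) (sqrt_le_amgm hd0 hr0) hgain hhigh hvel htail
      rw [hsplit]
      calc ENNReal.ofReal (((N + 1 : ℕ) : ℝ) * ((∫ y, Set.indicator E φ y.1 * g y.2 ∂f) +
              ∫ y, Set.indicator Eᶜ φ y.1 * g y.2 ∂f) - k)
          ≤ ENNReal.ofReal (c * d) := ENNReal.ofReal_le_ofReal hmain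
        _ = ENNReal.ofReal c * production (cutDensity K θ u₀ Φ ν t) := by
          rw [ENNReal.ofReal_mul hc0.le, hdeq]
  -- integrate over the window and insert the core
  have hint : ∫⁻ t in Set.Ioo 0 h, ENNReal.ofReal ((∫ z, F (Φ.flow t z) ∂ν) - k) ≤
      ENNReal.ofReal c * ENNReal.ofReal (η * h) := by
    calc ∫⁻ t in Set.Ioo 0 h, ENNReal.ofReal ((∫ z, F (Φ.flow t z) ∂ν) - k)
        ≤ ∫⁻ t in Set.Ioo 0 h, ENNReal.ofReal c * production (cutDensity K θ u₀ Φ ν t) :=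
          lintegral_mono fun t => key t
      _ = ENNReal.ofReal c * ∫⁻ t in Set.Ioo 0 h, production (cutDensity K θ u₀ Φ ν t) :=
          lintegral_const_mul' _ _ ENNReal.ofReal_ne_top
      _ ≤ ENNReal.ofReal c * ENNReal.ofReal (η * h) := mul_le_mul_right hE4 _
  -- back to Bochner integrals
  have hB1 : ENNReal.ofReal (∫ t in Set.Ioo 0 h, ((∫ z, F (Φ.flow t z) ∂ν) - k)) ≤
      ∫⁻ t in Set.Ioo 0 h, ENNReal.ofReal ((∫ z, F (Φ.flow t z) ∂ν) - k) :=
    ofReal_integral_le_lintegral_ofReal_of_real _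
  have hB2 : ∫ t in Set.Ioo 0 h, ((∫ z, F (Φ.flow t z) ∂ν) - k) =
      (∫ t in (0 : ℝ)..h, ∫ z, F (Φ.flow t z) ∂ν) - h * k := by
    rw [← integral_Ioc_eq_integral_Ioo, ← intervalIntegral.integral_of_le hh.le,
      intervalIntegral.integral_sub hii intervalIntegrable_const, intervalIntegral.integral_const,
      sub_zero, smul_eq_mul]
  have hRHS0 : 0 ≤ c * (η * h) := by positivity
  have hB3 : (∫ t in (0 : ℝ)..h, ∫ z, F (Φ.flow t z) ∂ν) - h * k ≤ c * (η * h) := by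
    rw [← hB2, ← ENNReal.ofReal_le_ofReal_iff hRHS0, ENNReal.ofReal_mul hc0.le]
    exact hB1.trans hint
  -- the gain bound for `X`
  have hX : ∫ z, windowAvg Φ F h z ∂ν ≤
      ((N + 1 : ℕ) : ℝ) * (C₁ * r / 2 + 4 * (κ₁ / L)) + S * (1 / 2 + 2 * (κ₁ / L)) +
        ((N + 1 : ℕ) : ℝ) * C₁ / (2 * r) * η := by
    rw [hfub]
    have e : h⁻¹ * (h * k + c * (η * h)) = k + c * η := by
      field_simp
    calc h⁻¹ * ∫ t in (0 : ℝ)..h, ∫ z, F (Φ.flow t z) ∂ν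
        ≤ h⁻¹ * (h * k + c * (η * h)) :=
          mul_le_mul_of_nonneg_left (by linarith only [hB3]) (inv_nonneg.2 hh.le)
      _ = k + c * η := e
      _ = _ := by rw [hkdef, hcdef]
  have hfin := budget_arith_vanishing hn hS0 hδ hq1 hq2 h2 h3 hX
  calc (∫ z, windowAvg Φ F h z ∂ν) - (klDiv ν G).toReal ≤ δ * ((N + 1 : ℕ) : ℝ) := hfin
    _ = δ * (N + 1) := by push_cast; ring

end VanishingReduction

/-- **The core alone implies the crux** (registered stub `stub_vanishingReduction` of skeleton 1c449378, line
`h-theorem-dissipation-budget`): `VanishingWindowDissipationTilt → KineticFluxLdDecay` for both (syntactically identical)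
route copies, from the five landed stubs `stub_windowDuality`, `stub_oneBodyMarginal`, `stub_velocityEntropyBudget`,
`stub_gainDominationLocal`, `stub_positionTailBudget` (the route decls unfold to the frame's vocabulary). -/
theorem stub_vanishingReduction :
    VanishingWindowDissipationTilt →
      Summit.AtomisticToContinuum.HydrodynamicLimit.Theses.AntiMazurCoboundaries.KineticFluxLdDecay ∧
        Summit.AtomisticToContinuum.HydrodynamicLimit.Theses.FluxGibbsianityLdDrude.KineticFluxLdDecay := fun hE =>
  ⟨fun a θ u₀ ha hθ => VanishingReduction.lintegral_exp_windowAvg_le_of_vanishing stub_windowDuality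
      stub_oneBodyMarginal stub_velocityEntropyBudget stub_gainDominationLocal stub_positionTailBudget hE a θ u₀ ha hθ,
    fun a θ u₀ ha hθ => VanishingReduction.lintegral_exp_windowAvg_le_of_vanishing stub_windowDuality
      stub_oneBodyMarginal stub_velocityEntropyBudget stub_gainDominationLocal stub_positionTailBudget hE a θ u₀ ha hθ⟩

/-- Corollary in the shape the route files cite: the core implies the AntiMazurCoboundaries copy of the crux. -/
theorem kineticFluxLdDecay_of_vanishingWindowDissipationTilt (hE : VanishingWindowDissipationTilt) :
    Summit.AtomisticToContinuum.HydrodynamicLimit.Theses.AntiMazurCoboundaries.KineticFluxLdDecay :=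
  (stub_vanishingReduction hE).1

end Summit.AtomisticToContinuum.HydrodynamicLimit.Theorems.HTheorem

end
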